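import Summits.FinalStateConjecture.FinalStateConjecture.Theorems.PhotonSphereChannelsExteriorEnergyRW
import Literature.Analysis.Calculus.IntervalCauchySchwarz

/-!
# Crux `WindowedShellChannels` (stmt-FinalStateConjecture-14085), line `Sketch` — stub `stub_lateDropInvSq`
# (late drop of the lagged far energy under an inverse-square tail)

For `V ≥ 0` differentiable with `V(x) ≤ K/x²` on `x ≥ 1` (`K ≥ 1`), a global `C²` solution `ψ` of
`ψ_tt − ψ_xx + Vψ = 0` with Cauchy data supported in `[−R, R]` (`R ≥ 1`), a lag `H ≥ 0` and a time
`T ≥ H + K(R + H + 2)`: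
`farEnergy V (−H) ψ T ≤ farChannelEnergy V (−H) ψ atTop + (8K(R+H+2)/(T−H))·E`, `E` the total energy.

Proof (elementary characteristic transport, Fréchet bookkeeping of the `…Theorems.WaveEnergy` files,
`u = uncurry ψ`):
* support (`LateDrop.vanish`): `u` and its first partials vanish on `{R + 1 + |τ| ≤ y}`
  (`WaveEnergy.eq_zero_right_of_data`);
* size (`LateDrop.abs_le_sqrt`): `|u(τ, y)| ≤ √L·√E` whenever `y ≥ 0` lies within `L` of the support
  edge `R + 1 + τ` (fundamental theorem of calculus from the edge, Cauchy–Schwarz, `∫ u_x² ≤ E` by energy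
  conservation `WaveEnergy.integral_energy_eq_initial`);
* transport (`LateDrop.hasDerivAt_outgoing`): along the incoming characteristic `σ ↦ (σ, c − σ)` the
  outgoing derivative `w = u_t + u_x` obeys `dw/dσ = −Vu` (symmetry of second partials + the equation);
* flux bound (`LateDrop.flux_le`): for `t ≥ H + K(R+H+2)` the incoming flux density through the lagged
  edge `x = t − H`, `w² + Vu²`, is at most `2K(R+H+1)E/(t−H)²` (the characteristic through the edge
  point meets the support only during its last `(R+H+1)/2` units of time, where `V ≤ K/(t−H)²`);
* drop (`LateDrop.drop_le`): the energy identity with the moving left end `−H + t` and a fixed right end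
  beyond the support (`WaveEnergy.energy_identity_affine`; the right momentum flux vanishes) gives
  `farE(T) − farE(T₂) = ∫_T^{T₂} (w² + Vu²)(t, t − H) dt ≤ 2K(R+H+1)E/(T−H)`;
* `stub_lateDropInvSq`: translation to the curried `deriv` vocabulary, the far energies as `ofReal` of
  interval integrals, and `liminf_{T₂ → ∞}`.

No definitions are introduced; standard material [folklore].
-/

noncomputable section

-- the tree's namespace `Summit.FinalStateConjecture.FinalStateConjecture.Theorems` repeats a component
-- by design (problem directory `Summits/FinalStateConjecture/FinalStateConjecture/…`)
set_option linter.dupNamespace false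

namespace Summit.FinalStateConjecture.FinalStateConjecture.Theorems.WindowedShellChannelsSketch

open Literature.Geometry.Lorentzian Literature.Geometry.Lorentzian.ReggeWheeler
open Filter Set MeasureTheory
open scoped ENNReal Topology

namespace LateDrop

section Frechet

variable {u : ℝ × ℝ → ℝ} {V : ℝ → ℝ} {e : ℝ × ℝ → ℝ} {R E : ℝ}
  (hu : ContDiff ℝ 2 u) (hV : Differentiable ℝ V) (hV0 : ∀ x, 0 ≤ V x)
  (hsol : ∀ z : ℝ × ℝ, fderiv ℝ (fderiv ℝ u) z (1, 0) (1, 0)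
    - fderiv ℝ (fderiv ℝ u) z (0, 1) (0, 1) + V z.2 * u z = 0)
  (he : ∀ z, e z = (fderiv ℝ u z (1, 0)) ^ 2 + (fderiv ℝ u z (0, 1)) ^ 2 + V z.2 * u z ^ 2)
  (hdata : ∀ y, y ≤ -(R + 1) ∨ R + 1 ≤ y → u (0, y) = 0 ∧ fderiv ℝ u (0, y) (1, 0) = 0)
  (hE0 : 0 ≤ E) (hEn : ∀ τ, 0 ≤ τ → ∫ x in (-(R + 1) - τ)..(R + 1 + τ), e (τ, x) ≤ E)

include hu hsol in
/-- **Transport of the outgoing derivative along incoming characteristics.** For a `C²` solution of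
`u_tt − u_xx + Vu = 0`, along `σ ↦ (σ, c − σ)` the outgoing derivative `w = u_t + u_x` satisfies
`d/dσ w(σ, c − σ) = −V(c − σ) u(σ, c − σ)` (`= u_tt − u_xx` by symmetry of second partials). [folklore] -/
theorem hasDerivAt_outgoing (c τ : ℝ) :
    HasDerivAt (fun σ => fderiv ℝ u (σ, c - σ) (1, 0) + fderiv ℝ u (σ, c - σ) (0, 1))
      (-(V (c - τ) * u (τ, c - τ))) τ := by
  have hγ : HasDerivAt (fun σ : ℝ => (σ, c - σ)) ((1 : ℝ), -(1 : ℝ)) τ :=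
    (hasDerivAt_id' τ).prodMk ((hasDerivAt_id' τ).const_sub c)
  have h1 := WaveEnergy.hasDerivAt_comp_curve (WaveEnergy.differentiable_fderiv_apply hu (1, 0)) hγ
  have h2 := WaveEnergy.hasDerivAt_comp_curve (WaveEnergy.differentiable_fderiv_apply hu (0, 1)) hγ
  refine (h1.add h2).congr_deriv ?_
  rw [WaveEnergy.fderiv_fderiv_apply hu, WaveEnergy.fderiv_fderiv_apply hu]
  have hv : ((1 : ℝ), -(1 : ℝ)) = ((1 : ℝ), (0 : ℝ)) - ((0 : ℝ), (1 : ℝ)) := by ext <;> simp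
  rw [hv, map_sub, sub_apply, sub_apply,
    WaveEnergy.fderiv_fderiv_symm hu (τ, c - τ) (0, 1) (1, 0)]
  have hs := hsol (τ, c - τ)
  simp only at hs
  linear_combination hs

include hu hV hV0 hsol hdata in
/-- **Support.** Right of the light cone of the data, `{R + 1 + |τ| ≤ y}`, the solution and its first
partials vanish. [folklore] -/
theorem vanish {τ y : ℝ} (hy : R + 1 + |τ| ≤ y) (v : ℝ × ℝ) :
    u (τ, y) = 0 ∧ fderiv ℝ u (τ, y) v = 0 :=
  WaveEnergy.eq_zero_right_of_data hu hV hV0 hsol (c := R + 1) (fun y hy => (hdata y (Or.inr hy)).1)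
    (fun y hy => (hdata y (Or.inr hy)).2) hy v

include hu hV hV0 hsol he hdata hEn in
/-- **Size.** For `τ ≥ 0` and `y ≥ 0` within `L` of the support edge `R + 1 + τ`:
`|u(τ, y)| ≤ √L · √E` — `u(τ, y) = −∫_y^{R+1+τ} u_x(τ, ·)`, Cauchy–Schwarz, and `∫ u_x² ≤ ∫ e ≤ E`.
[folklore] -/
theorem abs_le_sqrt {τ y L : ℝ} (hτ : 0 ≤ τ) (hy0 : 0 ≤ y) (hy : R + 1 + τ - L ≤ y) (hR : 0 ≤ R) :
    |u (τ, y)| ≤ Real.sqrt L * Real.sqrt E := by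
  rcases le_or_gt (R + 1 + τ) y with hby | hby
  · have h := (vanish hu hV hV0 hsol hdata (τ := τ) (y := y) (by rwa [abs_of_nonneg hτ]) (1, 0)).1
    rw [h, abs_zero]
    positivity
  have hud := WaveEnergy.differentiable_of_contDiff_two hu
  have hcx : Continuous fun s => fderiv ℝ u (τ, s) (0, 1) :=
    (WaveEnergy.continuous_fderiv_apply hu (0, 1)).comp (Continuous.prodMk_right τ)
  have hec : Continuous fun s => e (τ, s) :=
    (WaveEnergy.continuous_energyDensity hu hV he).comp (Continuous.prodMk_right τ)
  have hftc : ∫ s in y..(R + 1 + τ), fderiv ℝ u (τ, s) (0, 1) = u (τ, R + 1 + τ) - u (τ, y) :=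
    intervalIntegral.integral_eq_sub_of_hasDerivAt
      (fun s _ => WaveEnergy.hasDerivAt_slice_snd hud τ s) (hcx.intervalIntegrable _ _)
  have hub : u (τ, R + 1 + τ) = 0 :=
    (vanish hu hV hV0 hsol hdata (τ := τ) (y := R + 1 + τ) (by rw [abs_of_nonneg hτ]) (1, 0)).1
  have hcs := Literature.Analysis.Calculus.abs_intervalIntegral_mul_le_sqrt (f := fun _ => (1 : ℝ))
    (g := fun s => fderiv ℝ u (τ, s) (0, 1)) continuous_const hcx hby.le
  simp only [one_mul, one_pow, intervalIntegral.integral_const, smul_eq_mul, mul_one] at hcs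
  rw [hftc, hub, zero_sub, abs_neg] at hcs
  refine hcs.trans (mul_le_mul (Real.sqrt_le_sqrt (by linarith)) (Real.sqrt_le_sqrt ?_)
    (Real.sqrt_nonneg _) (Real.sqrt_nonneg _))
  calc ∫ s in y..(R + 1 + τ), fderiv ℝ u (τ, s) (0, 1) ^ 2
      ≤ ∫ s in y..(R + 1 + τ), e (τ, s) := by
        refine intervalIntegral.integral_mono_on hby.le ((hcx.pow 2).intervalIntegrable _ _)
          (hec.intervalIntegrable _ _) fun s _ => ?_
        rw [he]
        nlinarith [sq_nonneg (fderiv ℝ u (τ, s) (1, 0)), mul_nonneg (hV0 s) (sq_nonneg (u (τ, s)))]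
    _ ≤ ∫ s in (-(R + 1) - τ)..(R + 1 + τ), e (τ, s) :=
        intervalIntegral.integral_mono_interval (by linarith) hby.le le_rfl
          (Eventually.of_forall fun s => WaveEnergy.energyDensity_nonneg hV0 he _)
          (hec.intervalIntegrable _ _)
    _ ≤ E := hEn τ hτ

include hu hV hV0 hsol he hdata hE0 hEn in
/-- **Flux bound.** For `K ≥ 1`, `V ≤ K/x²` on `x ≥ 1`, `R ≥ 1`, `H ≥ 0` and `t ≥ H + K(R + H + 2)`, the
incoming flux density through the lagged edge point `(t, t − H)` satisfies
`(u_t + u_x)² + Vu² ≤ 2K(R+H+1)E/(t−H)²`: the characteristic `σ ↦ (σ, 2t − H − σ)` enters the support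
at `σ₀ = t − (R+H+1)/2 ≥ 0` with `w(σ₀) = 0`, and on `[σ₀, t]` one has `V ≤ K/(t−H)²`,
`|u| ≤ √(R+H+1)·√E`, so `|w(t, t−H)| ≤ (R+H+1)/2 · K/(t−H)² · √((R+H+1)E)` (mean value inequality).
[folklore] -/
theorem flux_le {K H t : ℝ} (hK : 1 ≤ K) (hVK : ∀ x, 1 ≤ x → V x ≤ K / x ^ 2) (hR : 1 ≤ R)
    (hH : 0 ≤ H) (ht : H + K * (R + H + 2) ≤ t) :
    (fderiv ℝ u (t, -H + t) (1, 0) + fderiv ℝ u (t, -H + t) (0, 1)) ^ 2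
        + V (-H + t) * u (t, -H + t) ^ 2
      ≤ 2 * K * (R + H + 1) * E / (-H + t) ^ 2 := by
  set L := R + H + 1 with hL
  set s := -H + t with hs
  have hL1 : 1 ≤ L := by rw [hL]; linarith
  have hKL' : L + 1 ≤ K * (L + 1) := by nlinarith
  have hKL : K * (L + 1) ≤ s := by rw [hs, hL]; linarith
  have hs1 : 1 ≤ s := by linarith
  have hs0 : 0 < s := by linarith
  have ht0 : 0 ≤ t - L / 2 := by rw [hs] at hKL; linarith
  set c := t + s with hc
  set MV := K / s ^ 2 with hMV
  have hMV0 : 0 ≤ MV := by positivity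
  set B := Real.sqrt L * Real.sqrt E with hB
  have hB2 : B ^ 2 = L * E := by rw [hB, mul_pow, Real.sq_sqrt (by linarith), Real.sq_sqrt hE0]
  -- on the characteristic segment `σ ∈ [t - L/2, t]`, `x = c - σ ∈ [s, s + L/2]`
  have hVle : ∀ τ, τ ≤ t → V (c - τ) ≤ MV := by
    intro τ hτ
    have h1 : s ≤ c - τ := by rw [hc]; linarith
    calc V (c - τ) ≤ K / (c - τ) ^ 2 := hVK _ (hs1.trans h1)
      _ ≤ MV :=
        div_le_div_of_nonneg_left (by linarith) (by positivity) (pow_le_pow_left₀ hs0.le h1 2)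
  have hule : ∀ τ, t - L / 2 ≤ τ → τ ≤ t → |u (τ, c - τ)| ≤ B := by
    intro τ h1 h2
    refine abs_le_sqrt hu hV hV0 hsol he hdata hEn (by linarith) ?_ ?_ (by linarith)
    · rw [hc]; linarith
    · rw [hc, hs, hL]; linarith
  -- transport from the entry point `σ₀ = t - L/2`, where `w = 0`
  have hy0 : R + 1 + |t - L / 2| ≤ c - (t - L / 2) := by
    rw [abs_of_nonneg ht0, hc, hs, hL]; linarith
  have hg0 : fderiv ℝ u (t - L / 2, c - (t - L / 2)) (1, 0)
      + fderiv ℝ u (t - L / 2, c - (t - L / 2)) (0, 1) = 0 := by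
    rw [(vanish hu hV hV0 hsol hdata hy0 (1, 0)).2, (vanish hu hV hV0 hsol hdata hy0 (0, 1)).2,
      add_zero]
  have hmv : ‖(fderiv ℝ u (t, c - t) (1, 0) + fderiv ℝ u (t, c - t) (0, 1))
      - (fderiv ℝ u (t - L / 2, c - (t - L / 2)) (1, 0)
        + fderiv ℝ u (t - L / 2, c - (t - L / 2)) (0, 1))‖ ≤ MV * B * (t - (t - L / 2)) :=
    norm_image_sub_le_of_norm_deriv_le_segment'
      (f := fun σ => fderiv ℝ u (σ, c - σ) (1, 0) + fderiv ℝ u (σ, c - σ) (0, 1))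
      (f' := fun σ => -(V (c - σ) * u (σ, c - σ))) (a := t - L / 2) (b := t)
      (fun τ _ => (hasDerivAt_outgoing hu hsol c τ).hasDerivWithinAt)
      (fun τ hτ => by
        rw [norm_neg, Real.norm_eq_abs, abs_mul, abs_of_nonneg (hV0 _)]
        exact mul_le_mul (hVle τ hτ.2.le) (hule τ hτ.1 hτ.2.le) (abs_nonneg _) hMV0)
      t (right_mem_Icc.2 (by linarith))
  have hct : c - t = s := by rw [hc]; ring
  rw [hg0, sub_zero, Real.norm_eq_abs, hct, show t - (t - L / 2) = L / 2 by ring] at hmv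
  have hA : (fderiv ℝ u (t, s) (1, 0) + fderiv ℝ u (t, s) (0, 1)) ^ 2
      ≤ MV * (MV * L ^ 2 / 4) * (L * E) := by
    have h2 := pow_le_pow_left₀ (abs_nonneg _) hmv 2
    rw [sq_abs] at h2
    calc _ ≤ (MV * B * (L / 2)) ^ 2 := h2
      _ = MV * (MV * L ^ 2 / 4) * B ^ 2 := by ring
      _ = _ := by rw [hB2]
  have hP : V s * u (t, s) ^ 2 ≤ MV * (L * E) := by
    have h1 : |u (t, s)| ≤ B := by have h := hule t (by linarith) le_rfl; rwa [hct] at h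
    have h2 := pow_le_pow_left₀ (abs_nonneg _) h1 2
    rw [sq_abs, hB2] at h2
    have h3 : V s ≤ MV := by have h := hVle t le_rfl; rwa [hct] at h
    exact mul_le_mul h3 h2 (sq_nonneg _) hMV0
  have hX : MV * L ^ 2 / 4 ≤ 1 := by
    rw [hMV, div_mul_eq_mul_div, div_div, div_le_one (by positivity)]
    have h1 : K * (L + 1) * (K * (L + 1)) ≤ s * s := mul_le_mul hKL hKL (by positivity) hs0.le
    nlinarith [h1, hK, hL1]
  have hLE : 0 ≤ L * E := by positivity
  calc _ ≤ MV * (MV * L ^ 2 / 4) * (L * E) + MV * (L * E) := add_le_add hA hP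
    _ ≤ MV * 1 * (L * E) + MV * (L * E) := by gcongr
    _ = 2 * K * L * E / s ^ 2 := by rw [hMV]; ring

include hu hV hV0 hsol he hdata hE0 hEn in
/-- **Late drop of the lagged far energy (real form).** For `T ≤ T₂`, with the right end `X = R + 1 + T₂`
beyond the support: `∫_{T−H}^{X} e(T,·) ≤ ∫_{T₂−H}^{X} e(T₂,·) + 2K(R+H+1)E/(T−H)` — the energy identity
with the moving left end `−H + t` (influx `(u_t + u_x)² + Vu²`, bounded by `flux_le` and integrated
against `(t − H)⁻²`) and the fixed right end `X` (no flux). [folklore] -/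
theorem drop_le {K H T T₂ : ℝ} (hK : 1 ≤ K) (hVK : ∀ x, 1 ≤ x → V x ≤ K / x ^ 2) (hR : 1 ≤ R)
    (hH : 0 ≤ H) (hT : H + K * (R + H + 2) ≤ T) (hT₂ : T ≤ T₂) :
    ∫ x in (-H + T)..(R + 1 + T₂), e (T, x)
      ≤ (∫ x in (-H + T₂)..(R + 1 + T₂), e (T₂, x)) + 2 * K * (R + H + 1) * E / (-H + T) := by
  set X := R + 1 + T₂ with hX
  set C := 2 * K * (R + H + 1) * E with hC
  have hC0 : 0 ≤ C := by rw [hC]; positivity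
  have hKp : R + H + 2 ≤ K * (R + H + 2) := by nlinarith
  have hHT : 0 < -H + T := by linarith
  obtain ⟨m, hm⟩ : ∃ m : ℝ × ℝ → ℝ, ∀ z, m z = 2 * fderiv ℝ u z (1, 0) * fderiv ℝ u z (0, 1) :=
    ⟨_, fun _ => rfl⟩
  have key := WaveEnergy.energy_identity_affine hu hV hsol he hm (-H) 1 X 0 T T₂
  simp only [one_mul, zero_mul, add_zero] at key
  -- the influx through the moving left end; no flux through `x = X`
  set Φ : ℝ → ℝ := fun t => (fderiv ℝ u (t, -H + t) (1, 0) + fderiv ℝ u (t, -H + t) (0, 1)) ^ 2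
    + V (-H + t) * u (t, -H + t) ^ 2 with hΦ
  have hrhs : (∫ t in T..T₂, (m (t, X) - (m (t, -H + t) + e (t, -H + t))))
      = -∫ t in T..T₂, Φ t := by
    rw [← intervalIntegral.integral_neg]
    refine intervalIntegral.integral_congr fun t ht => ?_
    rw [uIcc_of_le hT₂] at ht
    have h0 := (vanish hu hV hV0 hsol hdata (τ := t) (y := X)
      (by rw [abs_of_nonneg (by linarith [ht.1]), hX]; linarith [ht.2]) (1, 0)).2
    simp only [hΦ, hm, he, h0]
    ring
  have hΦc : Continuous Φ := by
    have h1 := WaveEnergy.continuous_fderiv_apply hu (1, 0)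
    have h2 := WaveEnergy.continuous_fderiv_apply hu (0, 1)
    have h3 := hu.continuous
    have h4 := hV.continuous
    simp only [hΦ]
    fun_prop
  -- integrate the pointwise bound `Φ t ≤ C/(t - H)²`
  have hg : ∀ t, 0 < -H + t → HasDerivAt (fun τ => -C * (-H + τ)⁻¹) (C / (-H + t) ^ 2) t := by
    intro t ht
    have h := (((hasDerivAt_id' t).const_add (-H)).inv ht.ne').const_mul (-C)
    exact h.congr_deriv (by ring)
  have hint : (∫ t in T..T₂, Φ t) ≤ -C * (-H + T₂)⁻¹ - -C * (-H + T)⁻¹ :=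
    intervalIntegral.integral_le_sub_of_hasDeriv_right_of_le hT₂
      (fun t ht => (hg t (by linarith [ht.1])).continuousAt.continuousWithinAt)
      (fun t ht => (hg t (by linarith [ht.1])).hasDerivWithinAt) hΦc.integrableOn_Icc
      (fun t ht => by
        have h := flux_le hu hV hV0 hsol he hdata hE0 hEn hK hVK hR hH (t := t) (by linarith [ht.1])
        simpa only [hΦ, hC] using h)
  have hpos : 0 ≤ C * (-H + T₂)⁻¹ := mul_nonneg hC0 (inv_nonneg.2 (by linarith))
  have hfin : -C * (-H + T₂)⁻¹ - -C * (-H + T)⁻¹ ≤ C / (-H + T) := by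
    rw [div_eq_mul_inv]; linarith
  linarith

end Frechet

end LateDrop

/-- **Stub `stub_lateDropInvSq` (late drop under an inverse-square tail).** Let `V ≥ 0` be differentiable
with `V(x) ≤ K/x²` on `x ≥ 1` (`K ≥ 1`), and let `ψ` be a global `C²` solution with Cauchy data supported
in `[−R, R]` (`R ≥ 1`). For a lag `H ≥ 0` and a time `T ≥ H + K(R+H+2)` the far energy beyond the
lagged edge `x = t − H` has almost converged:
`farEnergy V (−H) ψ T ≤ farChannelEnergy V (−H) ψ atTop + (8K(R+H+2)/(T−H))·E`.
(For every `T₂ ≥ T` the drop `farE(T) − farE(T₂)` is the influx `∫_T^{T₂} [(ψ_t+ψ_x)² + Vψ²](t, t−H) dt`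
through the lagged edge, bounded by `LateDrop.drop_le`; then `liminf_{T₂ → ∞}`.) [folklore] -/
theorem stub_lateDropInvSq : ∀ (V : ℝ → ℝ) (K : ℝ), Differentiable ℝ V → (∀ x, 0 ≤ V x) → 1 ≤ K →
    (∀ x, 1 ≤ x → V x ≤ K / x ^ 2) →
    ∀ R H T : ℝ, 1 ≤ R → 0 ≤ H → H + K * (R + H + 2) ≤ T → ∀ ψ : ℝ → ℝ → ℝ, IsSolution V ψ →
      CauchyDataSupportedOn ψ (Icc (-R) R) →
        farEnergy V (-H) ψ T ≤ farChannelEnergy V (-H) ψ atTop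
          + ENNReal.ofReal (8 * K * (R + H + 2) / (T - H)) * totalEnergy V ψ 0 := by
  intro V K hV hV0 hK hVK R H T hR hH hT ψ hψ hsupp
  have hC := hψ.1
  have hKp : R + H + 2 ≤ K * (R + H + 2) := by nlinarith
  have hT0 : 0 ≤ T := by linarith
  have hTH : 0 < T - H := by linarith
  have hK0 : 0 < K := by linarith
  have hR0 : 0 < R := by linarith
  -- Fréchet form of the equation, the energy density and the data
  have hsol' : ∀ z : ℝ × ℝ, fderiv ℝ (fderiv ℝ (Function.uncurry ψ)) z (1, 0) (1, 0)
      - fderiv ℝ (fderiv ℝ (Function.uncurry ψ)) z (0, 1) (0, 1)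
      + V z.2 * Function.uncurry ψ z = 0 := by
    rintro ⟨t, x⟩
    rw [← WaveEnergy.iteratedDeriv_two_slice_fst_eq hC,
      ← WaveEnergy.iteratedDeriv_two_slice_snd_eq hC]
    exact hψ.2 (t, x)
  obtain ⟨e, he⟩ : ∃ e : ℝ × ℝ → ℝ, ∀ z, e z = (fderiv ℝ (Function.uncurry ψ) z (1, 0)) ^ 2
      + (fderiv ℝ (Function.uncurry ψ) z (0, 1)) ^ 2 + V z.2 * Function.uncurry ψ z ^ 2 :=
    ⟨_, fun _ => rfl⟩
  have he' : ∀ t x, energyDensity V ψ t x = e (t, x) := fun t x => by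
    simp only [he, energyDensity, WaveEnergy.deriv_slice_fst_eq hC,
      WaveEnergy.deriv_slice_snd_eq hC, Function.uncurry_apply_pair]
  have hdata : ∀ y, y ≤ -(R + 1) ∨ R + 1 ≤ y →
      Function.uncurry ψ (0, y) = 0 ∧ fderiv ℝ (Function.uncurry ψ) (0, y) (1, 0) = 0 := by
    intro y hy
    have hy' : y ∉ Icc (-R) R := fun h => by rcases hy with hy | hy <;> linarith [h.1, h.2]
    refine ⟨(hsupp y hy').1, ?_⟩
    rw [← WaveEnergy.deriv_slice_fst_eq hC]
    exact (hsupp y hy').2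
  -- the (conserved, finite) total energy
  obtain ⟨E, hE⟩ : ∃ E : ℝ, E = ∫ x in (-(R + 1))..(R + 1), e (0, x) := ⟨_, rfl⟩
  have hE0 : 0 ≤ E := by
    rw [hE]
    exact intervalIntegral.integral_nonneg (by linarith) fun x _ =>
      WaveEnergy.energyDensity_nonneg hV0 he _
  have hEn : ∀ τ, 0 ≤ τ → ∫ x in (-(R + 1) - τ)..(R + 1 + τ), e (τ, x) ≤ E := fun τ hτ => by
    rw [hE]
    exact (WaveEnergy.integral_energy_eq_initial hC hV hV0 hsol' he hdata (t := τ) (T := τ)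
      (by rw [abs_of_nonneg hτ])).le
  have htot : totalEnergy V ψ 0 = ENNReal.ofReal E := by
    have hdata2 : CauchyDataSupportedOn ψ (Ioo (-(R + 1)) (R + 1)) :=
      fun y hy => hsupp y fun h => hy ⟨by linarith [h.1], by linarith [h.2]⟩
    rw [RW.totalEnergy_eq hV hV0 hψ (by linarith) hdata2 0, hE]
    congr 1
    exact intervalIntegral.integral_congr fun x _ => he' 0 x
  -- the lagged far energy at `t ≥ 0` as a real integral up to any `X` beyond the support
  have hfar : ∀ t X : ℝ, 0 ≤ t → R + 1 + t ≤ X →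
      farEnergy V (-H) ψ t = ENNReal.ofReal (∫ x in (-H + t)..X, e (t, x)) := by
    intro t X ht hX
    have hec : Continuous fun y => e (t, y) :=
      (WaveEnergy.continuous_energyDensity hC hV he).comp (Continuous.prodMk_right t)
    unfold farEnergy
    rw [abs_of_nonneg ht]
    have hset : {x : ℝ | -H + t < x} = Ioc (-H + t) X ∪ Ioi X :=
      (Ioc_union_Ioi_eq_Ioi (by linarith)).symm
    rw [hset, lintegral_union measurableSet_Ioi Ioc_disjoint_Ioi_same,
      setLIntegral_eq_zero measurableSet_Ioi, add_zero]
    · simp only [he']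
      exact WaveEnergy.lintegral_Ioc_eq_ofReal_intervalIntegral hec
        (fun y => WaveEnergy.energyDensity_nonneg hV0 he _) (by linarith)
    · intro x hx
      have h := LateDrop.vanish hC hV hV0 hsol' hdata (τ := t) (y := x)
        (by rw [abs_of_nonneg ht]; exact hX.trans (le_of_lt hx))
      simp only [Pi.zero_apply, he', he, (h (1, 0)).2, (h (0, 1)).2, (h (1, 0)).1]
      simp
  -- finite times: `farE(T) ≤ farE(T₂) + bound` for every `T₂ ≥ T`
  set Kc := ENNReal.ofReal (8 * K * (R + H + 2) / (T - H)) * ENNReal.ofReal E with hKc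
  have hcoef : 2 * K * (R + H + 1) * E / (-H + T) ≤ 8 * K * (R + H + 2) / (T - H) * E := by
    rw [show -H + T = T - H by ring, div_mul_eq_mul_div]
    refine div_le_div_of_nonneg_right ?_ hTH.le
    have h := mul_nonneg (mul_nonneg hK0.le hE0) (by linarith : (0 : ℝ) ≤ 6 * R + 6 * H + 14)
    nlinarith [h]
  have hev : ∀ᶠ T₂ in atTop, farEnergy V (-H) ψ T ≤ farEnergy V (-H) ψ T₂ + Kc := by
    filter_upwards [eventually_ge_atTop T] with T₂ hT₂
    rw [hfar T (R + 1 + T₂) hT0 (by linarith), hfar T₂ (R + 1 + T₂) (hT0.trans hT₂) le_rfl, hKc,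
      ← ENNReal.ofReal_mul (div_nonneg (by positivity) hTH.le)]
    have hd := LateDrop.drop_le hC hV hV0 hsol' he hdata hE0 hEn hK hVK hR hH hT hT₂
    calc ENNReal.ofReal (∫ x in (-H + T)..(R + 1 + T₂), e (T, x))
        ≤ ENNReal.ofReal ((∫ x in (-H + T₂)..(R + 1 + T₂), e (T₂, x))
            + 8 * K * (R + H + 2) / (T - H) * E) := ENNReal.ofReal_le_ofReal (by linarith)
      _ ≤ _ := ENNReal.ofReal_add_le
  -- pass to `liminf`
  rw [htot]
  unfold farChannelEnergy
  have h1 : farEnergy V (-H) ψ T - Kc ≤ liminf (farEnergy V (-H) ψ) atTop :=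
    le_liminf_of_le (by isBoundedDefault) (hev.mono fun t ht => tsub_le_iff_right.2 ht)
  calc farEnergy V (-H) ψ T ≤ farEnergy V (-H) ψ T - Kc + Kc := le_tsub_add
    _ ≤ liminf (farEnergy V (-H) ψ) atTop + Kc := by gcongr

end Summit.FinalStateConjecture.FinalStateConjecture.Theorems.WindowedShellChannelsSketch

end
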